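import Literature.MathematicalPhysics.QuantumFieldTheory.Balaban1983to89.B11Eq98CurrentSlot
import Literature.MathematicalPhysics.QuantumFieldTheory.Balaban1983to89.B8SectDSource
import Literature.MathematicalPhysics.QuantumFieldTheory.Balaban1983to89.B12SecondOrder267

/-!
# `Balaban1983to89.B11Ineq73KernelLettersPerLattice` — T. Bałaban, *The variational problem and background fields in renormalization group method
# for lattice gauge theories*, Commun. Math. Phys. **102** (1985) 277–309 [Balaban1985Variational]: (73) p. 289 (+ the remark «𝔇₂ … (73) with ε₃²
# instead of ε₃»), (55)–(57) p. 286, (78) p. 290, (86)–(89) p. 291 — THE KERNEL-COLUMN LETTERS `θ_E`, `θ₃` OF THE (98)-SLOT OF `W = (δ/δA′)V`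
# (`B11Eq98CurrentSlot.quadAnalytic_W80`'s binders `hΘE`, `hΘ3` on the kernels of `(HD)′(A′)`, `(HD₃)′(A′)`) EXIST AT A FIXED LATTICE, from the
# Sect. C regime alone (Cauchy estimates + finiteness of the bond set; NO decay, NO uniformity)

statement-level skeleton of published theorems with citation tags; proofs where landed; nothing here is a claim about the Yang–Mills mass gap

PDF held: `paper:balaban1985-cmp102-variational-background` (journal page = PDF page + 276); pp. 286–291 read by this seat in the held text layer
(p0011, p0014–p0017; 2026-08-21/22).

THE PRINT (verbatim).  p. 289: *«|𝔇(A′; c, b)| ≦ O(1)C₃ε₃(Lʲη)^{−d+1}e^{−(1/2)δ₀d(c₋,y)}, b ∈ Bʲ(y), y ∈ Λ_j. (73)»*; *«The operator 𝔇(A′) is an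
analytic function in A′, and its expansion begins with a linear term in A′, coming from the differentiation of D^{(2)}(A′) = C^{(2)}(A′). If we
subtract these terms from 𝔇(A′), then we get an operator 𝔇₂(A′) for which we have the bound (73) with ε₃² instead of ε₃.»*; p. 286 (55): *«|D(A′)| …
≦ 4C₂|A′|²₍₋₁₎. (55) This implies that a power series expansion of D(A′) begins with second order terms»*, (56) *«D^{(2)}(A′) = C_j^{(2)}(LʲηA′)»*.
WHAT IS PROVED is NOT (73): it is the PER-LATTICE existence of the two constants the crew's (E) displays; print's `O(1)` is uniform in the lattice
BECAUSE of the decay factor, not reproduced here.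

WHY THIS FILE (cell context).  ne9-leaf-05's (E) `B11Eq98CurrentSlot.quadAnalytic_W80` proves both W-slot clauses of the owner's
`NE9CurChartOfBackground.cur_chart_exists_of_W_H126` for the typed `W80` under the DISPLAYED letters `hΘE : ∀ A′, ‖A′‖ < R′ → ∀ b,
Σ_{b′}(w₃(b)/w₃(b′))‖k_{(HD)′(A′)}(b′, b)‖ ≤ θ_E‖A′‖` and `hΘ3 : … ‖k_{(HD₃)′(A′)}(b′, b)‖ ≤ θ₃‖A′‖²` (`kernel`, `levWeight`; `Emap = HD`, `E3 = HD₃` of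
`B11Eq80Current`).  Here both are INHABITED at every fixed lattice from `Regime H 0 C b 0 C₂ c₄ 0 a_C ε_C` + `Prop4Hyp C C₂ c₄` (the currency of the
owner's E170–E173 «finite-lattice numbers»); direction = t4-ne9-idea-1 g38's offer (u2′) (scratch re-proved, never imported) in the CONSUMER's typed
form (its caveat «op-norm = row sums, hΘE∕hΘ3 = column sums» is answered per lattice by the finite bond set, §2; «E3 = rem3 Emap» is side-stepped, §4).

WHAT IS PROVED (sorry-free; no definition; no `Prop` placeholder; nothing of [B11]'s inequalities asserted).
* §1 **`norm_fderiv_le_of_pow_bound`** (Cauchy, power form: `‖Φ z‖ ≤ β‖z‖ⁿ⁺¹` on `‖z‖ < a`, differentiable ⇒ `‖DΦ(x)‖ ≤ βaⁿ⁺¹/(R′ⁿ(a − R′))·‖x‖ⁿ` for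
  `0 < ‖x‖ < R′ < a`; the tree's `B8SectDSource.norm_fderiv_le_of_norm_le` on the ball of radius `‖x‖a/R′`).
* §2 `norm_kernel_le`, **`colSum_kernel_le`** — PER LATTICE `Σ_{b′}(w₃(b)/w₃(b′))‖k_M(b′, b)‖ ≤ κ‖M‖`, `κ = Σ_b Σ_{b′}(w₃(b)/w₃(b′))‖eval_{b′}‖‖δ_b‖`.
* §3 ((55)+(57) = (E)'s `norm_Emap_le_sq`, imported) **`norm_fderiv_Emap_le`** (`‖(HD)′(A′)‖ ≤ bC₂ℓ²a_C²/(R′(a_C − R′))·‖A′‖`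
  on `‖A′‖ < R′ < a_C`), **`colSum_kernel_fderiv_Emap_le`** (`hΘE` with the EXPLICIT `θ_E = κ·bC₂ℓ²a_C²/(R′(a_C − R′))`), **`exists_thetaE`**.
* §4 `norm_quadPart_sub_le` (polarization difference of `C⁽²⁾`), **`exists_cubic_remainder`** (`‖C(Z) − C⁽²⁾(Z)‖ ≤ K₃‖Z‖³` near `0`: Osgood ⇒ `C` analytic
  at `0`; `p₀ = p₁ = 0`, `p₂ = C⁽²⁾` by `B12SecondOrder267`'s coefficient lemmas; Mathlib's `HasFPowerSeriesAt.isBigO_sub_partialSum_pow`),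
  **`exists_cubic_bound_E3`** (`‖HD₃(A′)‖ ≤ γ‖A′‖³` on some `‖A′‖ < R₃ ≤ a_C`), **`exists_theta3`**, **`exists_thetaE_theta3`** (both binders, common ball).
* §5 **`exists_quadAnalytic_W80`** — (E)'s `quadAnalytic_W80` FED: `∃ R′ > 0, ∃ C₄ ≥ 0, QuadAnalytic (W80 …) C₄ R′ ∧ AnalyticOnNhd …` for ANY `J`, `Δπ`,
  under `RC`, `hC`, `0 < a_C` and the V₀-group's slot `hqV` ONLY — the W-slot clauses of `cur_chart_exists_of_W_H126` for `W80` with no kernel letter.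
HONEST SCOPE.  (i) PER-LATTICE constants only (`κ` counts bonds and inverse weights; `K₃`, `γ`, `R₃` from a power-series radius at `0`) — NO decay,
NO «C₄ depends on d and L only», NO (73) as printed.  (ii) Nothing instantiated at the chain's `H`, `C` (leaf-03's PART E); feeding (E) is the
consumer's one-liner.  (iii) NOT summit progress (cell pub-balaban: NE9 NOT PRINTED / NOT PROVED; «NE9 ⇐ the named binders»; spine PROVED 0/9;
HONEST DEPENDENCY: continuum YM on T⁴ ⇐ BetaPertH ∧ nine spine estimates (0/9 proved); BetaPertH ⇐ (D1) ∧ (D4) ∧ CAP+tail; G-an2-4 gates asym, D1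
and NE2/3/4).  Filed by the NE9 leaf seat `b2b-balaban-t4-ne9-formalise-leaf-01` (gen 73); NEW file; imports (E) `B11Eq98CurrentSlot`, `B8SectDSource`,
`B12SecondOrder267`; nothing modified.  Net new unproved facts: 0.
-/

noncomputable section

open scoped BigOperators
namespace Literature.MathematicalPhysics.QuantumFieldTheory.Balaban1983to89.B11Ineq73KernelLettersPerLattice

open Metric Set Filter Topology Asymptotics
open Literature.MathematicalPhysics.QuantumFieldTheory.Balaban1983to89.B11Prop6Scheme (Prop4Hyp)
open Literature.MathematicalPhysics.QuantumFieldTheory.Balaban1983to89.B11Eq174Chart (Regime)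
open Literature.MathematicalPhysics.QuantumFieldTheory.Balaban1983to89.B11Eq90Transpose (kernel single115)
open Literature.MathematicalPhysics.QuantumFieldTheory.Balaban1983to89.B11Eq90V0GroupComposed (T47 norm_T47_le norm_T47_lt)
open Literature.MathematicalPhysics.QuantumFieldTheory.Balaban1983to89.B11Eq80Current (Emap E3 Emap_eq_H analyticOnNhd_Emap analyticOnNhd_E3)
open Literature.MathematicalPhysics.QuantumFieldTheory.Balaban1983to89.B11Eq98CurrentSlot (norm_Emap_le_sq)
open B9SectCLatticeCarrier (Bond)
open B11Eq115Space

/-! ## §1 Cauchy: a power value bound on a ball gives a power bound of one degree less on the Fréchet derivative -/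

/-- **Cauchy's estimate, power form**: if `Φ` is complex-differentiable on `‖z‖ < a` with `‖Φ z‖ ≤ β‖z‖ⁿ⁺¹` there, then for `0 < R′ < a`
and `0 < ‖x‖ < R′`: `‖DΦ(x)‖ ≤ β·aⁿ⁺¹/(R′ⁿ(a − R′)) · ‖x‖ⁿ` — Cauchy on the ball of radius `‖x‖a/R′ ⊂ ball 0 a`, on which `‖Φ‖ ≤ β(‖x‖a/R′)ⁿ⁺¹`
(the tree's `B8SectDSource.norm_fderiv_le_of_norm_le`); the device of (53)–(54) applied to a derivative, as for (73).
[cite: Balaban1985Variational, (73) p.289, (53)–(54) p.286] -/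
theorem norm_fderiv_le_of_pow_bound {E F : Type*} [NormedAddCommGroup E] [NormedSpace ℂ E] [NormedAddCommGroup F] [NormedSpace ℂ F]
    {Φ : E → F} {a β R' : ℝ} {n : ℕ} (hd : DifferentiableOn ℂ Φ (ball (0 : E) a))
    (hβ : 0 ≤ β) (hΦ : ∀ z : E, ‖z‖ < a → ‖Φ z‖ ≤ β * ‖z‖ ^ (n + 1)) (hR' : 0 < R') (hR'a : R' < a)
    {x : E} (hx0 : x ≠ 0) (hx : ‖x‖ < R') :
    ‖fderiv ℂ Φ x‖ ≤ β * a ^ (n + 1) / (R' ^ n * (a - R')) * ‖x‖ ^ n := by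
  have ha : 0 < a := hR'.trans hR'a
  have hxpos : 0 < ‖x‖ := norm_pos_iff.2 hx0
  set ρ : ℝ := ‖x‖ * a / R' with hρ
  have hρa : ρ < a := by
    rw [hρ, div_lt_iff₀ hR']
    nlinarith
  have hxρ : ‖x‖ < ρ := by
    rw [hρ, lt_div_iff₀ hR']
    nlinarith
  have hdρ : DifferentiableOn ℂ Φ (ball (0 : E) ρ) := hd.mono (ball_subset_ball hρa.le)
  have hM : ∀ z ∈ ball (0 : E) ρ, ‖Φ z‖ ≤ β * ρ ^ (n + 1) := by
    intro z hz
    rw [mem_ball_zero_iff] at hz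
    exact (hΦ z (hz.trans hρa)).trans (by gcongr)
  have h := B8SectDSource.norm_fderiv_le_of_norm_le hdρ hM hxρ
  have haR : 0 < a - R' := sub_pos.2 hR'a
  have hR'ne : R' ≠ 0 := hR'.ne'
  have hxne : ‖x‖ ≠ 0 := hxpos.ne'
  have haRne : a - R' ≠ 0 := haR.ne'
  have hsub : ρ - ‖x‖ = ‖x‖ * (a - R') / R' := by rw [hρ]; field_simp
  rw [hsub] at h
  refine h.trans (le_of_eq ?_)
  rw [hρ, div_pow, mul_pow, pow_succ R' n]
  field_simp
  ring
variable {𝔸 : Type*} [NormedRing 𝔸] [NormedAlgebra ℂ 𝔸] [FiniteDimensional ℂ 𝔸]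
variable {d : ℕ} {Pd : Fin d → ℕ} {L η : ℝ} [Fact (0 < L)] [Fact (0 < η)] {lev₀ : Bond d Pd → ℕ} {κ' : Type*} [Fintype κ']
  {lev₁ : κ' → ℕ} {Dc : (Bond d Pd → 𝔸) →ₗ[ℂ] (κ' → 𝔸)}
variable {𝒳 : Type*} [NormedAddCommGroup 𝒳] [NormedSpace ℂ 𝒳]
variable {H : 𝒳 →L[ℂ] Space115 L η lev₀ lev₁ Dc} {C : Space115 L η lev₀ lev₁ Dc → 𝒳} {b C₂ c₄ aC εC : ℝ}

/-! ## §2 Per lattice, a weighted kernel COLUMN sum is bounded by the operator norm -/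

section Columns

/-- Each kernel entry `k_M(b′, b) = eval_{b′} ∘ M ∘ δ_b` is bounded by `‖eval_{b′}‖·‖M‖·‖δ_b‖`. [cite: Balaban1985Variational, (63) p.287, (85) p.291] -/
theorem norm_kernel_le (M : Space115 L η lev₀ lev₁ Dc →L[ℂ] Space115 L η lev₀ lev₁ Dc) (b' b : Bond d Pd) :
    ‖kernel M b' b‖ ≤ ‖JetSup.evalCLM (𝕜 := ℂ) (levWeight L η lev₀ 1) (levWeight L η lev₁ 2) Dc b'‖ * ‖M‖
      * ‖single115 (L := L) (η := η) (lev₀ := lev₀) (lev₁ := lev₁) (Dc := Dc) b‖ := by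
  unfold kernel
  calc _ ≤ ‖JetSup.evalCLM (𝕜 := ℂ) (levWeight L η lev₀ 1) (levWeight L η lev₁ 2) Dc b'‖ * ‖M.comp (single115 (lev₁ := lev₁) (Dc := Dc) b)‖ :=
        ContinuousLinearMap.opNorm_comp_le _ _
    _ ≤ _ := by rw [mul_assoc]; gcongr; exact ContinuousLinearMap.opNorm_comp_le _ _

/-- **PER LATTICE, THE WEIGHTED COLUMN SUM OF THE KERNEL IS BOUNDED BY THE OPERATOR NORM**: `Σ_{b′}(w₃(b)/w₃(b′))‖k_M(b′, b)‖ ≤ κ·‖M‖` with the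
finite-lattice constant `κ = Σ_b Σ_{b′} (w₃(b)/w₃(b′))·‖eval_{b′}‖·‖δ_b‖` (a finite sum over the bonds; NO decay used — print's (73) carries
`e^{−(1/2)δ₀d(c₋,y)}`, which is what makes its column sums lattice-independent). [cite: Balaban1985Variational, (73) p.289, (86) p.291] -/
theorem colSum_kernel_le (M : Space115 L η lev₀ lev₁ Dc →L[ℂ] Space115 L η lev₀ lev₁ Dc) (b : Bond d Pd) :
    ∑ b' : Bond d Pd, levWeight L η lev₀ 3 b / levWeight L η lev₀ 3 b' * ‖kernel M b' b‖
      ≤ (∑ bb : Bond d Pd, ∑ b' : Bond d Pd, levWeight L η lev₀ 3 bb / levWeight L η lev₀ 3 b'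
          * ‖JetSup.evalCLM (𝕜 := ℂ) (levWeight L η lev₀ 1) (levWeight L η lev₁ 2) Dc b'‖
          * ‖single115 (L := L) (η := η) (lev₀ := lev₀) (lev₁ := lev₁) (Dc := Dc) bb‖) * ‖M‖ := by
  have hw : ∀ b : Bond d Pd, 0 < levWeight L η lev₀ 3 b := levWeight_pos (Fact.out : 0 < L) (Fact.out : 0 < η) lev₀ 3
  have hterm : ∀ bb : Bond d Pd, 0 ≤ ∑ b' : Bond d Pd, levWeight L η lev₀ 3 bb / levWeight L η lev₀ 3 b'
      * ‖JetSup.evalCLM (𝕜 := ℂ) (levWeight L η lev₀ 1) (levWeight L η lev₁ 2) Dc b'‖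
      * ‖single115 (L := L) (η := η) (lev₀ := lev₀) (lev₁ := lev₁) (Dc := Dc) bb‖ := fun bb =>
    Finset.sum_nonneg fun b' _ => by have := (hw bb).le; have := (hw b').le; positivity
  calc ∑ b' : Bond d Pd, levWeight L η lev₀ 3 b / levWeight L η lev₀ 3 b' * ‖kernel M b' b‖
      ≤ ∑ b' : Bond d Pd, levWeight L η lev₀ 3 b / levWeight L η lev₀ 3 b'
          * (‖JetSup.evalCLM (𝕜 := ℂ) (levWeight L η lev₀ 1) (levWeight L η lev₁ 2) Dc b'‖ * ‖M‖
            * ‖single115 (L := L) (η := η) (lev₀ := lev₀) (lev₁ := lev₁) (Dc := Dc) b‖) := by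
        gcongr with b' _
        · exact div_nonneg (hw b).le (hw b').le
        · exact norm_kernel_le M b' b
    _ = (∑ b' : Bond d Pd, levWeight L η lev₀ 3 b / levWeight L η lev₀ 3 b'
          * ‖JetSup.evalCLM (𝕜 := ℂ) (levWeight L η lev₀ 1) (levWeight L η lev₁ 2) Dc b'‖
          * ‖single115 (L := L) (η := η) (lev₀ := lev₀) (lev₁ := lev₁) (Dc := Dc) b‖) * ‖M‖ := by
        rw [Finset.sum_mul]; exact Finset.sum_congr rfl fun _ _ => by ring
    _ ≤ _ := by
        refine mul_le_mul_of_nonneg_right ?_ (norm_nonneg _)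
        exact Finset.single_le_sum (f := fun bb => ∑ b' : Bond d Pd, levWeight L η lev₀ 3 bb / levWeight L η lev₀ 3 b'
          * ‖JetSup.evalCLM (𝕜 := ℂ) (levWeight L η lev₀ 1) (levWeight L η lev₁ 2) Dc b'‖
          * ‖single115 (L := L) (η := η) (lev₀ := lev₀) (lev₁ := lev₁) (Dc := Dc) bb‖) (fun bb _ => hterm bb) (Finset.mem_univ b)

end Columns

/-! ## §3 θ_E EXISTS PER LATTICE: the kernel-column letter of `(HD)′(A′)` on `‖A′‖ < R′ < a_C` -/

section ThetaE

open Literature.MathematicalPhysics.QuantumFieldTheory.Balaban1983to89.B12SecondOrder267 (fderiv_zero_of_norm_le_sq)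

/-- **THE OPERATOR NORM OF `(HD)′(A′)` IS LINEAR IN `‖A′‖` ON `‖A′‖ < R′ < a_C`**: `‖(HD)′(A′)‖ ≤ bC₂ℓ²a_C²/(R′(a_C − R′))·‖A′‖` — print's (73)
«𝔇(A′) = O(|A′|)» composed with (46), here PER LATTICE from the quadratic value bound (55)/(57) and Cauchy's estimate (§1), with NO decay.
[cite: Balaban1985Variational, (73) p.289, (46) p.285, (55) p.286] -/
theorem norm_fderiv_Emap_le [CompleteSpace 𝔸] (RC : Regime H 0 C b 0 C₂ c₄ 0 aC εC) (hC : Prop4Hyp C C₂ c₄) {R' : ℝ} (hR'0 : 0 < R')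
    (hR'a : R' < aC) {A' : Space115 L η lev₀ lev₁ Dc} (hA' : ‖A'‖ < R') :
    ‖fderiv ℂ (Emap H C εC) A'‖
      ≤ b * C₂ * (1 / (1 - 4 * b * C₂ * (εC + aC))) ^ 2 * aC ^ 2 / (R' * (aC - R')) * ‖A'‖ := by
  have hβ : 0 ≤ b * C₂ * (1 / (1 - 4 * b * C₂ * (εC + aC))) ^ 2 := by
    have := mul_nonneg RC.B₀_nonneg RC.C₄_nonneg; positivity
  have hd : DifferentiableOn ℂ (Emap H C εC) (ball (0 : Space115 L η lev₀ lev₁ Dc) aC) := (analyticOnNhd_Emap RC hC).differentiableOn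
  rcases eq_or_ne A' 0 with rfl | hA0
  · rw [fderiv_zero_of_norm_le_sq (𝕜 := ℂ) (hR'0.trans hR'a) fun z hz => norm_Emap_le_sq RC hz, norm_zero, norm_zero, mul_zero]
  · have h := norm_fderiv_le_of_pow_bound (n := 1) hd hβ (fun z hz => by simpa using norm_Emap_le_sq RC hz) hR'0 hR'a hA0 hA'
    simpa [pow_one] using h

/-- **θ_E EXISTS PER LATTICE — the binder `hΘE` of (E)'s `norm_W80_le_sq` ∕ `quadAnalytic_W80(_Jcur)` INHABITED with an explicit finite-lattice
number**: on `‖A′‖ < R′ < a_C`, for every bond `b`, `Σ_{b′}(w₃(b)/w₃(b′))‖k_{(HD)′(A′)}(b′, b)‖ ≤ θ_E‖A′‖` with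
`θ_E = κ · bC₂ℓ²a_C²/(R′(a_C − R′))`, `κ` the column constant of §2. Per lattice ONLY: print's (73) has `O(1)` uniform in the lattice thanks
to the decay `e^{−(1/2)δ₀d(c₋,y)}`; nothing of that is reproduced. [cite: Balaban1985Variational, (73) p.289, (86)–(88) p.291] -/
theorem colSum_kernel_fderiv_Emap_le [CompleteSpace 𝔸] (RC : Regime H 0 C b 0 C₂ c₄ 0 aC εC) (hC : Prop4Hyp C C₂ c₄) {R' : ℝ}
    (hR'0 : 0 < R') (hR'a : R' < aC) {A' : Space115 L η lev₀ lev₁ Dc} (hA' : ‖A'‖ < R') (bb : Bond d Pd) :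
    ∑ b' : Bond d Pd, levWeight L η lev₀ 3 bb / levWeight L η lev₀ 3 b' * ‖kernel (fderiv ℂ (Emap H C εC) A') b' bb‖
      ≤ (∑ bb : Bond d Pd, ∑ b' : Bond d Pd, levWeight L η lev₀ 3 bb / levWeight L η lev₀ 3 b'
            * ‖JetSup.evalCLM (𝕜 := ℂ) (levWeight L η lev₀ 1) (levWeight L η lev₁ 2) Dc b'‖
            * ‖single115 (L := L) (η := η) (lev₀ := lev₀) (lev₁ := lev₁) (Dc := Dc) bb‖)
          * (b * C₂ * (1 / (1 - 4 * b * C₂ * (εC + aC))) ^ 2 * aC ^ 2 / (R' * (aC - R'))) * ‖A'‖ := by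
  have hκ : 0 ≤ ∑ bb : Bond d Pd, ∑ b' : Bond d Pd, levWeight L η lev₀ 3 bb / levWeight L η lev₀ 3 b'
      * ‖JetSup.evalCLM (𝕜 := ℂ) (levWeight L η lev₀ 1) (levWeight L η lev₁ 2) Dc b'‖
      * ‖single115 (L := L) (η := η) (lev₀ := lev₀) (lev₁ := lev₁) (Dc := Dc) bb‖ := by
    have hw : ∀ b : Bond d Pd, 0 < levWeight L η lev₀ 3 b := levWeight_pos (Fact.out : 0 < L) (Fact.out : 0 < η) lev₀ 3
    exact Finset.sum_nonneg fun bb _ => Finset.sum_nonneg fun b' _ => by have := (hw bb).le; have := (hw b').le; positivity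
  calc _ ≤ _ * ‖fderiv ℂ (Emap H C εC) A'‖ := colSum_kernel_le _ bb
    _ ≤ _ * (b * C₂ * (1 / (1 - 4 * b * C₂ * (εC + aC))) ^ 2 * aC ^ 2 / (R' * (aC - R')) * ‖A'‖) :=
        mul_le_mul_of_nonneg_left (norm_fderiv_Emap_le RC hC hR'0 hR'a hA') hκ
    _ = _ := by ring

/-- **`hΘE` AS AN EXISTENCE STATEMENT**: for `0 < R′ < a_C` there is `θ_E ≥ 0` (a finite-lattice number) with
`∀ A′, ‖A′‖ < R′ → ∀ b, Σ_{b′}(w₃(b)/w₃(b′))‖k_{(HD)′(A′)}(b′, b)‖ ≤ θ_E‖A′‖` — the shape of (E)'s binder VERBATIM.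
[cite: Balaban1985Variational, (73) p.289, Prop. 4 (98) p.293] -/
theorem exists_thetaE [CompleteSpace 𝔸] (RC : Regime H 0 C b 0 C₂ c₄ 0 aC εC) (hC : Prop4Hyp C C₂ c₄) {R' : ℝ} (hR'0 : 0 < R')
    (hR'a : R' < aC) :
    ∃ θE : ℝ, 0 ≤ θE ∧ ∀ A' : Space115 L η lev₀ lev₁ Dc, ‖A'‖ < R' → ∀ bb : Bond d Pd, ∑ b' : Bond d Pd,
      levWeight L η lev₀ 3 bb / levWeight L η lev₀ 3 b' * ‖kernel (fderiv ℂ (Emap H C εC) A') b' bb‖ ≤ θE * ‖A'‖ := by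
  refine ⟨_, ?_, fun A' hA' bb => colSum_kernel_fderiv_Emap_le RC hC hR'0 hR'a hA' bb⟩
  have hw : ∀ b : Bond d Pd, 0 < levWeight L η lev₀ 3 b := levWeight_pos (Fact.out : 0 < L) (Fact.out : 0 < η) lev₀ 3
  have hβ : 0 ≤ b * C₂ * (1 / (1 - 4 * b * C₂ * (εC + aC))) ^ 2 := by
    have := mul_nonneg RC.B₀_nonneg RC.C₄_nonneg; positivity
  have haC : 0 < aC := hR'0.trans hR'a
  have haR : 0 < aC - R' := sub_pos.2 hR'a
  refine mul_nonneg (Finset.sum_nonneg fun bb _ => Finset.sum_nonneg fun b' _ => ?_) (by positivity)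
  have := (hw bb).le; have := (hw b').le; positivity

end ThetaE

/-! ## §4 θ₃ EXISTS PER LATTICE: a cubic value bound on `HD₃ = HD − HC⁽²⁾` near `0`, then Cauchy -/

section Theta3

open Literature.MathematicalPhysics.QuantumFieldTheory.Balaban1983to89.B11Eq80Current (quadPart Emap_eq_sub)
open Literature.MathematicalPhysics.QuantumFieldTheory.Balaban1983to89.B12SecondOrder267 (coeff_zero_eq_zero coeff_one_eq_zero
  coeff_diag_eq_inv_factorial_smul eq_zero_of_norm_le_sq fderiv_zero_of_norm_le_sq)

omit [FiniteDimensional ℂ 𝔸] in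
/-- **The polarization difference of the second-order part**: `‖C⁽²⁾(A) − C⁽²⁾(Y)‖ ≤ ‖D²C(0)‖·max(‖A‖, ‖Y‖)·‖A − Y‖` (multilinearity of
`D²C(0)`; print's «C^{(2)}(A′, A″)» polarization of (56)). [cite: Balaban1985Variational, (56) p.286, (78) p.290] -/
theorem norm_quadPart_sub_le (C : Space115 L η lev₀ lev₁ Dc → 𝒳) (A Y : Space115 L η lev₀ lev₁ Dc) :
    ‖quadPart C A - quadPart C Y‖ ≤ ‖iteratedFDeriv ℂ 2 C 0‖ * max ‖A‖ ‖Y‖ * ‖A - Y‖ := by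
  rw [quadPart, quadPart, ← smul_sub, norm_smul]
  have h := (iteratedFDeriv ℂ 2 C 0).norm_image_sub_le (fun _ : Fin 2 => A) (fun _ : Fin 2 => Y)
  have hv : ‖(fun _ : Fin 2 => A)‖ = ‖A‖ := pi_norm_const A
  have hw : ‖(fun _ : Fin 2 => Y)‖ = ‖Y‖ := pi_norm_const Y
  have hvw : ‖(fun _ : Fin 2 => A) - (fun _ : Fin 2 => Y)‖ = ‖A - Y‖ := by
    rw [show ((fun _ : Fin 2 => A) - fun _ : Fin 2 => Y) = fun _ : Fin 2 => A - Y from rfl]; exact pi_norm_const (A - Y)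
  rw [hv, hw, hvw, Fintype.card_fin] at h
  simp only [Nat.cast_ofNat, Nat.add_one_sub_one, pow_one] at h
  have h2 : ‖(2 : ℂ)⁻¹‖ = 2⁻¹ := by simp
  rw [h2]
  calc 2⁻¹ * ‖iteratedFDeriv ℂ 2 C 0 (fun _ => A) - iteratedFDeriv ℂ 2 C 0 (fun _ => Y)‖
      ≤ 2⁻¹ * (‖iteratedFDeriv ℂ 2 C 0‖ * 2 * max ‖A‖ ‖Y‖ * ‖A - Y‖) := by gcongr
    _ = ‖iteratedFDeriv ℂ 2 C 0‖ * max ‖A‖ ‖Y‖ * ‖A - Y‖ := by ring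

/-- **The Taylor remainder of `C` at order three near `0` EXISTS**: `C` quadratic-analytic on `‖Y‖ < c₄` (finite-dimensional carrier ⇒ analytic
at `0`, Osgood; its expansion has `p₀ = 0`, `p₁ = 0`, `p₂(Y,Y) = C⁽²⁾(Y)`), so `‖C(Z) − C⁽²⁾(Z)‖ ≤ K₃‖Z‖³` on some ball `‖Z‖ < r₁` — (56)/(136):
«C_k can be decomposed further into a sum of homogeneous polynomials» with the order-≥ 3 tail `O(|A|³)`, existence-level constant.
[cite: Balaban1985Variational, (56) p.286; Balaban1985Averaging, (136) p.39] -/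
theorem exists_cubic_remainder [CompleteSpace 𝒳] (hC : Prop4Hyp C C₂ c₄) (hc₄ : 0 < c₄) :
    ∃ r₁ : ℝ, 0 < r₁ ∧ ∃ K₃ : ℝ, 0 ≤ K₃ ∧ ∀ Z : Space115 L η lev₀ lev₁ Dc, ‖Z‖ < r₁ → ‖C Z - quadPart C Z‖ ≤ K₃ * ‖Z‖ ^ 3 := by
  have hU : IsOpen {Y : Space115 L η lev₀ lev₁ Dc | ‖Y‖ < c₄} := isOpen_lt continuous_norm continuous_const
  have hCa : AnalyticAt ℂ C 0 :=
    Literature.Analysis.Complex.SCV.analyticAt_of_differentiableOn hC.differentiableOn hU (by simpa using hc₄)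
  obtain ⟨p, hp⟩ := hCa
  have h0 : p 0 = 0 := coeff_zero_eq_zero hp (eq_zero_of_norm_le_sq hc₄ hC.quad)
  have h1 : p 1 = 0 := coeff_one_eq_zero hp (fderiv_zero_of_norm_le_sq hc₄ hC.quad)
  have h2 : ∀ y : Space115 L η lev₀ lev₁ Dc, p 2 (fun _ => y) = quadPart C y := fun y => by
    rw [coeff_diag_eq_inv_factorial_smul hp 2 y, quadPart]
    norm_num
  have hps : ∀ y : Space115 L η lev₀ lev₁ Dc, p.partialSum 3 y = quadPart C y := fun y => by
    simp only [FormalMultilinearSeries.partialSum, Finset.sum_range_succ, Finset.sum_range_zero, h0, h1, zero_add,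
      zero_apply, h2]
  obtain ⟨c, hc⟩ := (hp.isBigO_sub_partialSum_pow 3).bound
  obtain ⟨r₁, hr₁, hball⟩ := Metric.eventually_nhds_iff_ball.1 hc
  refine ⟨r₁, hr₁, max c 0, le_max_right _ _, fun Z hZ => ?_⟩
  have h := hball Z (mem_ball_zero_iff.2 hZ)
  rw [zero_add, hps, Real.norm_of_nonneg (by positivity)] at h
  exact h.trans (mul_le_mul_of_nonneg_right (le_max_left _ _) (by positivity))

/-- **A CUBIC VALUE BOUND ON `HD₃(A′) = HD(A′) − HC⁽²⁾(A′)` NEAR `0` EXISTS** — print's «the part of D of order ≥ 3» ((78), (56) «D⁽²⁾ = C⁽²⁾»):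
`∃ R₃ ∈ (0, a_C], ∃ γ ≥ 0, ‖A′‖ < R₃ ⇒ ‖HD₃(A′)‖ ≤ γ‖A′‖³`, from `HD₃ = H[C(A) − C⁽²⁾(A)] + H[C⁽²⁾(A) − C⁽²⁾(A′)]`, `A = T47 A′` (‖A‖ ≤ ℓ‖A′‖,
`‖A − A′‖ = ‖HD(A′)‖ ≤ bC₂ℓ²‖A′‖²`), the Taylor remainder of `C` and the polarization difference — VALUE level only, no second-order chain rule.
[cite: Balaban1985Variational, (78) p.290, (55)–(57) p.286] -/
theorem exists_cubic_bound_E3 [CompleteSpace 𝒳] [CompleteSpace 𝔸] (RC : Regime H 0 C b 0 C₂ c₄ 0 aC εC) (hC : Prop4Hyp C C₂ c₄)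
    (haC : 0 < aC) :
    ∃ R₃ : ℝ, 0 < R₃ ∧ R₃ ≤ aC ∧ ∃ γ : ℝ, 0 ≤ γ ∧ ∀ Y : Space115 L η lev₀ lev₁ Dc, ‖Y‖ < R₃ → ‖E3 H C εC Y‖ ≤ γ * ‖Y‖ ^ 3 := by
  have hc₄ : 0 < c₄ := by linarith [RC.dom, RC.ε₄_nonneg]
  obtain ⟨r₁, hr₁, K₃, hK₃, hrem⟩ := exists_cubic_remainder (L := L) (η := η) (lev₀ := lev₀) (lev₁ := lev₁) (Dc := Dc) hC hc₄
  set ℓ : ℝ := 1 / (1 - 4 * b * C₂ * (εC + aC)) with hℓ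
  have hq : 0 < 1 - 4 * b * C₂ * (εC + aC) := by linarith [RC.contr]
  have hℓ0 : 0 < ℓ := by rw [hℓ]; positivity
  set β : ℝ := b * C₂ * ℓ ^ 2 with hβ
  have hbC : 0 ≤ b * C₂ := mul_nonneg RC.B₀_nonneg RC.C₄_nonneg
  have hβ0 : 0 ≤ β := by rw [hβ]; positivity
  refine ⟨min aC (r₁ / (ℓ + 1)), lt_min haC (by positivity), min_le_left _ _,
    b * (K₃ * ℓ ^ 3 + ‖iteratedFDeriv ℂ 2 C 0‖ * (ℓ + 1) * β), by have := RC.B₀_nonneg; positivity, fun Y hY => ?_⟩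
  have hYa : ‖Y‖ < aC := lt_of_lt_of_le hY (min_le_left _ _)
  have hYr : ‖Y‖ < r₁ / (ℓ + 1) := lt_of_lt_of_le hY (min_le_right _ _)
  -- the argument `A = T47 Y`
  have hA : ‖T47 H C εC Y‖ ≤ ℓ * ‖Y‖ := by rw [hℓ, one_div_mul_eq_div]; exact norm_T47_le RC hYa
  have hAr : ‖T47 H C εC Y‖ < r₁ := by
    calc ‖T47 H C εC Y‖ ≤ ℓ * ‖Y‖ := hA
      _ ≤ (ℓ + 1) * ‖Y‖ := by gcongr; linarith
      _ < (ℓ + 1) * (r₁ / (ℓ + 1)) := by gcongr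
      _ = r₁ := by field_simp
  have hAY : ‖T47 H C εC Y - Y‖ ≤ β * ‖Y‖ ^ 2 := by
    rw [show T47 H C εC Y - Y = -Emap H C εC Y by rw [Emap_eq_sub]; abel, norm_neg, hβ, hℓ]
    exact norm_Emap_le_sq RC hYa
  have hmax : max ‖T47 H C εC Y‖ ‖Y‖ ≤ (ℓ + 1) * ‖Y‖ :=
    max_le (hA.trans (by gcongr; linarith)) (by nlinarith [norm_nonneg Y])
  -- the decomposition
  have hdec : E3 H C εC Y = H (C (T47 H C εC Y) - quadPart C (T47 H C εC Y)) + H (quadPart C (T47 H C εC Y) - quadPart C Y) := by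
    rw [E3, Emap_eq_H RC hYa, map_sub, map_sub]; abel
  rw [hdec]
  have h1 : ‖H (C (T47 H C εC Y) - quadPart C (T47 H C εC Y))‖ ≤ b * (K₃ * ℓ ^ 3) * ‖Y‖ ^ 3 := by
    calc _ ≤ b * ‖C (T47 H C εC Y) - quadPart C (T47 H C εC Y)‖ := RC.norm_G _
      _ ≤ b * (K₃ * ‖T47 H C εC Y‖ ^ 3) := mul_le_mul_of_nonneg_left (hrem _ hAr) RC.B₀_nonneg
      _ ≤ b * (K₃ * (ℓ * ‖Y‖) ^ 3) := by gcongr; exact RC.B₀_nonneg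
      _ = b * (K₃ * ℓ ^ 3) * ‖Y‖ ^ 3 := by ring
  have h2 : ‖H (quadPart C (T47 H C εC Y) - quadPart C Y)‖ ≤ b * (‖iteratedFDeriv ℂ 2 C 0‖ * (ℓ + 1) * β) * ‖Y‖ ^ 3 := by
    calc _ ≤ b * ‖quadPart C (T47 H C εC Y) - quadPart C Y‖ := RC.norm_G _
      _ ≤ b * (‖iteratedFDeriv ℂ 2 C 0‖ * max ‖T47 H C εC Y‖ ‖Y‖ * ‖T47 H C εC Y - Y‖) :=
          mul_le_mul_of_nonneg_left (norm_quadPart_sub_le C _ _) RC.B₀_nonneg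
      _ ≤ b * (‖iteratedFDeriv ℂ 2 C 0‖ * ((ℓ + 1) * ‖Y‖) * (β * ‖Y‖ ^ 2)) := by gcongr; exact RC.B₀_nonneg
      _ = b * (‖iteratedFDeriv ℂ 2 C 0‖ * (ℓ + 1) * β) * ‖Y‖ ^ 3 := by ring
  calc _ ≤ ‖H (C (T47 H C εC Y) - quadPart C (T47 H C εC Y))‖ + ‖H (quadPart C (T47 H C εC Y) - quadPart C Y)‖ := norm_add_le _ _
    _ ≤ b * (K₃ * ℓ ^ 3) * ‖Y‖ ^ 3 + b * (‖iteratedFDeriv ℂ 2 C 0‖ * (ℓ + 1) * β) * ‖Y‖ ^ 3 := add_le_add h1 h2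
    _ = b * (K₃ * ℓ ^ 3 + ‖iteratedFDeriv ℂ 2 C 0‖ * (ℓ + 1) * β) * ‖Y‖ ^ 3 := by ring

/-- **θ₃ EXISTS PER LATTICE — the binder `hΘ3` of (E)'s `norm_W80_le_sq` ∕ `quadAnalytic_W80(_Jcur)` INHABITED** on every ball `‖A′‖ < R′` with
`R′ < R₃` (the radius of the cubic bound): `∃ θ₃ ≥ 0, ∀ A′, ‖A′‖ < R′ → ∀ b, Σ_{b′}(w₃(b)/w₃(b′))‖k_{(HD₃)′(A′)}(b′, b)‖ ≤ θ₃‖A′‖²` — print p. 289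
«for 𝔇₂ … the bound (73) with ε₃² instead of ε₃», here per lattice (Cauchy on the ball `‖A′‖R₃/R′` + the finite column constant `κ`).
[cite: Balaban1985Variational, (73) p.289, (86) p.291] -/
theorem exists_theta3 [CompleteSpace 𝒳] [CompleteSpace 𝔸] (RC : Regime H 0 C b 0 C₂ c₄ 0 aC εC) (hC : Prop4Hyp C C₂ c₄) (haC : 0 < aC) :
    ∃ R₃ : ℝ, 0 < R₃ ∧ R₃ ≤ aC ∧ ∀ R' : ℝ, 0 < R' → R' < R₃ →
      ∃ θ₃ : ℝ, 0 ≤ θ₃ ∧ ∀ A' : Space115 L η lev₀ lev₁ Dc, ‖A'‖ < R' → ∀ bb : Bond d Pd, ∑ b' : Bond d Pd,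
        levWeight L η lev₀ 3 bb / levWeight L η lev₀ 3 b' * ‖kernel (fderiv ℂ (E3 H C εC) A') b' bb‖ ≤ θ₃ * ‖A'‖ ^ 2 := by
  obtain ⟨R₃, hR₃, hR₃a, γ, hγ, hcub⟩ := exists_cubic_bound_E3 RC hC haC
  refine ⟨R₃, hR₃, hR₃a, fun R' hR'0 hR'R => ?_⟩
  have hw : ∀ b : Bond d Pd, 0 < levWeight L η lev₀ 3 b := levWeight_pos (Fact.out : 0 < L) (Fact.out : 0 < η) lev₀ 3
  set κ : ℝ := ∑ bb : Bond d Pd, ∑ b' : Bond d Pd, levWeight L η lev₀ 3 bb / levWeight L η lev₀ 3 b'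
      * ‖JetSup.evalCLM (𝕜 := ℂ) (levWeight L η lev₀ 1) (levWeight L η lev₁ 2) Dc b'‖
      * ‖single115 (L := L) (η := η) (lev₀ := lev₀) (lev₁ := lev₁) (Dc := Dc) bb‖ with hκ
  have hκ0 : 0 ≤ κ := Finset.sum_nonneg fun bb _ => Finset.sum_nonneg fun b' _ => by
    have := (hw bb).le; have := (hw b').le; positivity
  have hd : DifferentiableOn ℂ (E3 H C εC) (ball (0 : Space115 L η lev₀ lev₁ Dc) R₃) :=
    (analyticOnNhd_E3 RC hC).differentiableOn.mono (ball_subset_ball hR₃a)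
  have hR3R : 0 < R₃ - R' := sub_pos.2 hR'R
  refine ⟨κ * (γ * R₃ ^ 3 / (R' ^ 2 * (R₃ - R'))), by positivity, fun A' hA' bb => ?_⟩
  have hop : ‖fderiv ℂ (E3 H C εC) A'‖ ≤ γ * R₃ ^ 3 / (R' ^ 2 * (R₃ - R')) * ‖A'‖ ^ 2 := by
    rcases eq_or_ne A' 0 with rfl | hA0
    · -- a cubic bound is a quadratic one on the ball: `DHD₃(0) = 0`
      have hq : ∀ z : Space115 L η lev₀ lev₁ Dc, ‖z‖ < R₃ → ‖E3 H C εC z‖ ≤ γ * R₃ * ‖z‖ ^ 2 := fun z hz =>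
        (hcub z hz).trans (by
          calc γ * ‖z‖ ^ 3 = γ * ‖z‖ * ‖z‖ ^ 2 := by ring
            _ ≤ γ * R₃ * ‖z‖ ^ 2 := by gcongr)
      rw [fderiv_zero_of_norm_le_sq (𝕜 := ℂ) hR₃ hq, norm_zero, norm_zero]; positivity
    · exact norm_fderiv_le_of_pow_bound (n := 2) hd hγ hcub hR'0 hR'R hA0 hA'
  calc _ ≤ κ * ‖fderiv ℂ (E3 H C εC) A'‖ := colSum_kernel_le _ bb
    _ ≤ κ * (γ * R₃ ^ 3 / (R' ^ 2 * (R₃ - R')) * ‖A'‖ ^ 2) := mul_le_mul_of_nonneg_left hop hκ0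
    _ = _ := by ring

/-- **BOTH KERNEL-COLUMN LETTERS OF (E)'s PROPOSITION-4 SLOT EXIST PER LATTICE ON A COMMON BALL**: `∃ R′ ∈ (0, a_C), ∃ θ_E θ₃ ≥ 0` with the
`hΘE` and `hΘ3` binders of `B11Eq98CurrentSlot.norm_W80_le_sq` ∕ `quadAnalytic_W80` ∕ `quadAnalytic_W80_Jcur` on `‖A′‖ < R′` — so, at a FIXED
lattice, the W-slot's (98) constant `C₄ = C4W …` is a NUMBER once the remaining displays (`C_V`, ‖Δπ‖, ‖J‖ or (14)) are; print's «C₄ depend[s]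
on d and L only» is NOT reproduced. [cite: Balaban1985Variational, Prop. 4 (97)–(98) pp.292–293, (73) p.289] -/
theorem exists_thetaE_theta3 [CompleteSpace 𝒳] [CompleteSpace 𝔸] (RC : Regime H 0 C b 0 C₂ c₄ 0 aC εC) (hC : Prop4Hyp C C₂ c₄)
    (haC : 0 < aC) :
    ∃ R' : ℝ, 0 < R' ∧ R' < aC ∧ ∃ θE θ₃ : ℝ, 0 ≤ θE ∧ 0 ≤ θ₃ ∧
      (∀ A' : Space115 L η lev₀ lev₁ Dc, ‖A'‖ < R' → ∀ bb : Bond d Pd, ∑ b' : Bond d Pd,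
        levWeight L η lev₀ 3 bb / levWeight L η lev₀ 3 b' * ‖kernel (fderiv ℂ (Emap H C εC) A') b' bb‖ ≤ θE * ‖A'‖) ∧
      (∀ A' : Space115 L η lev₀ lev₁ Dc, ‖A'‖ < R' → ∀ bb : Bond d Pd, ∑ b' : Bond d Pd,
        levWeight L η lev₀ 3 bb / levWeight L η lev₀ 3 b' * ‖kernel (fderiv ℂ (E3 H C εC) A') b' bb‖ ≤ θ₃ * ‖A'‖ ^ 2) := by
  obtain ⟨R₃, hR₃, hR₃a, h3⟩ := exists_theta3 RC hC haC
  have hR' : 0 < R₃ / 2 := by positivity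
  have hR'R : R₃ / 2 < R₃ := by linarith
  have hR'a : R₃ / 2 < aC := lt_of_lt_of_le hR'R hR₃a
  obtain ⟨θ₃, hθ₃, hΘ3⟩ := h3 (R₃ / 2) hR' hR'R
  obtain ⟨θE, hθE, hΘE⟩ := exists_thetaE RC hC hR' hR'a
  exact ⟨R₃ / 2, hR', hR'a, θE, θ₃, hθE, hθ₃, hΘE, hΘ3⟩

end Theta3

/-! ## §5 The consumer's one-liner, done once: (E)'s Proposition-4 slot for `W80` with NO kernel letter at a fixed lattice -/

section Slot

open Literature.MathematicalPhysics.QuantumFieldTheory.Balaban1983to89.B13Contraction113 (QuadAnalytic)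
open Literature.MathematicalPhysics.QuantumFieldTheory.Balaban1983to89.B11Eq63V0GroupCurrent (curV0)
open Literature.MathematicalPhysics.QuantumFieldTheory.Balaban1983to89.B11Eq80Current (W80)
open Literature.MathematicalPhysics.QuantumFieldTheory.Balaban1983to89.B11Eq98CurrentSlot (quadAnalytic_W80 C4W_nonneg)

/-- **(E)'s PROPOSITION-4 SLOT FOR `W80` WITH NO KERNEL LETTER, AT A FIXED LATTICE**: under the Sect. C regime, `C` of Prop.-4 type, `0 < a_C`, the
V₀-group's slot `hqV` on some `R_V > 0`, and ANY letters `J`, `Δπ`: `∃ R′ > 0, ∃ C₄ ≥ 0, QuadAnalytic (W80 …) C₄ R′ ∧ AnalyticOnNhd ℂ (W80 …) {‖Y‖ < R′}`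
— `quadAnalytic_W80` fed by `exists_thetaE_theta3` on `R′ := min R₁ ((1 − 4bC₂(ε_C + a_C))R_V)`. Per lattice; `C₄` is (E)'s `C4W` at the θ's.
[cite: Balaban1985Variational, Prop. 4 (97)–(98) pp.292–293, (73) p.289] -/
theorem exists_quadAnalytic_W80 [CompleteSpace 𝒳] [CompleteSpace 𝔸] (ρ : (𝔸 →L[ℂ] ℂ) →L[ℂ] 𝔸) (τ : 𝔸 →L[ℂ] ℂ) (U₀ : Bond d Pd → 𝔸ˣ) {CV RV : ℝ} (hCV : 0 ≤ CV)
    (hRV : 0 < RV) (hqV : ∀ Y : Space115 L η lev₀ lev₁ Dc, ‖Y‖ < RV → ‖curV0 (lev₁ := lev₁) (Dc := Dc) ρ τ U₀ Y‖ ≤ CV * ‖Y‖ ^ 2)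
    (RC : Regime H 0 C b 0 C₂ c₄ 0 aC εC) (hC : Prop4Hyp C C₂ c₄) (haC : 0 < aC) (J : NegSize L η lev₀ 3 𝔸)
    (Δπ : Space115 L η lev₀ lev₁ Dc →L[ℂ] NegSize L η lev₀ 3 𝔸) :
    ∃ R' : ℝ, 0 < R' ∧ ∃ C₄ : ℝ, 0 ≤ C₄ ∧ QuadAnalytic (W80 ρ τ U₀ H C εC J Δπ) C₄ R' ∧
      AnalyticOnNhd ℂ (W80 ρ τ U₀ H C εC J Δπ) {Y : Space115 L η lev₀ lev₁ Dc | ‖Y‖ < R'} := by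
  obtain ⟨R₁, hR₁, hR₁a, θE, θ₃, hθE, hθ₃, hΘE, hΘ3⟩ := exists_thetaE_theta3 RC hC haC
  have hq : 0 < 1 - 4 * b * C₂ * (εC + aC) := by linarith [RC.contr]
  have hR'0 : 0 < min R₁ ((1 - 4 * b * C₂ * (εC + aC)) * RV) := lt_min hR₁ (mul_pos hq hRV)
  have hR'1 : min R₁ ((1 - 4 * b * C₂ * (εC + aC)) * RV) ≤ R₁ := min_le_left _ _
  refine ⟨_, hR'0, _, C4W_nonneg (norm_nonneg ρ) (norm_nonneg τ) (norm_nonneg J) (norm_nonneg Δπ) RC.B₀_nonneg RC.C₄_nonneg hθ₃ hθE hCV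
    hR'0.le, quadAnalytic_W80 ρ τ U₀ hCV hqV RC hC J Δπ hθ₃ hθE hR'0.le (hR'1.trans hR₁a.le) (min_le_right _ _)
    (fun A' hA' => hΘE A' (lt_of_lt_of_le hA' hR'1)) (fun A' hA' => hΘ3 A' (lt_of_lt_of_le hA' hR'1))⟩

end Slot

end Literature.MathematicalPhysics.QuantumFieldTheory.Balaban1983to89.B11Ineq73KernelLettersPerLattice

end
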